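import Literature.Probability.RandomPlanarGeometry.SAWScalingLimitFamily
import Literature.Probability.RandomPlanarGeometry.SAWBrickWallHex
import Literature.Probability.RandomPlanarGeometry.DiagonalDressedSAW
import Literature.Probability.LatticeModels.MeshDomainJordan
import Literature.Probability.Percolation.CubicCriticalProbHalfProofs
import HarnessLib

/-!
# `ModulusUniversality`, line `birth`: brick-wall-good endpoint approximations exist

Helper file (`--supports stmt-CriticalPhenomena-5790`) of the line `birth` / `registered` for the
crux `SAWBrickWallHomotopy.ModulusUniversality` (skeleton
`Summits/CriticalPhenomena/SAWScalingLimit/Cruxes/ModulusUniversality/Lines/birth.lean`, reshape 7,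
lead c3), first half of the registered PROVABLE stub `stub_boundaryAvoidanceBW_of_bwRobust` (W2):
the stub (R) = `stub_bwRobust` only speaks of `ℤ²` endpoint approximations along which the straight
critical brick-wall law `SAW.brickWallLaw E δ 0 (a δ) (b δ)` (`ℤ²` conventions: largest `ℤ²` mesh
component, closed-segment edge rule, brick-wall bonds only) is EVENTUALLY a probability measure, while
(BA_bw) is stated for every approximation; the gap is closed by patching a given approximation, off its
good meshes, with a brick-wall-good one, which this file constructs for every Dobrushin domain:

`exists_isEndpointApprox_isProbabilityMeasure_brickWallLaw` — interior points `z_n → E.pt 0`,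
`w_n → E.pt 1`; a bulk neighbourhood `V_n ∋ z_n, w_n` at distance `> ρ_n` from `Eᶜ`
(`exists_isOpen_isPreconnected_bulk`); the largest `ℤ²` mesh component of a Jordan domain contains
every compact for small `δ` (`JordanDomain.exists_forall_mem_meshDomain_and_reachable`, applied to
`{infDist(·, Eᶜ) ≥ ρ_n/2}`); BRICK-WALL connectivity of the bulk (`bw_reachable_of_mem_bulk`: the
locally-constant-component argument of `meshVertexGraph_reachable_of_mem_bulk` run with brick-wall
staircases `bw_reachable_of_box` — a deleted vertical bond `{(x,y),(x,y+1)}`, `x + y` odd, is bypassed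
through the column `x + 1`); a brick-wall self-avoiding path has weight `x_c(0)^{|γ|} 0⁰ > 0`, so the
law is a probability measure (`isProbabilityMeasure_brickWallLaw_zero_of_reachable`, finiteness of the
walk space `SAW.finite_domainSAW`); diagonal stage selection `exists_stage_tendsto_atTop`.
All bookkeeping tagged [folklore].  No definitions.
-/

noncomputable section

open MeasureTheory Filter Topology Metric Set
open scoped NNReal ENNReal
open Literature.Probability.LatticeModels
open Literature.Probability.RandomPlanarGeometry

namespace Summit.CriticalPhenomena.SAWScalingLimit.Cruxes.ModulusUniversality.Birth

open Literature.Probability.Percolation.CubicHalf (add_single_zero_apply_zero add_single_zero_apply_one)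

/-! ### 1. Brick-wall connectivity of the bulk of a discrete domain -/

/-- Coordinates of a lattice point shifted by a unit vector. [folklore] -/
theorem add_single_apply (a : Site 2) (i j : Fin 2) (s : ℤ) :
    (a + Pi.single i s : Site 2) j = a j + if j = i then s else 0 := by
  rw [Pi.add_apply, Pi.single_apply]

/-- The mesh point of the right neighbour `p + e₀` is `δ` to the right of the mesh point of `p`.
[folklore] -/
theorem dist_meshPoint_add_single_zero {δ : ℝ} (hδ : 0 ≤ δ) (p : Site 2) :
    dist (meshPoint δ (p + Pi.single 0 1)) (meshPoint δ p) = δ := by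
  rw [Complex.dist_eq]
  have hre : (meshPoint δ (p + Pi.single 0 1) - meshPoint δ p).re = δ := by
    rw [Complex.sub_re, meshPoint_re, meshPoint_re, add_single_zero_apply_zero, Int.cast_add,
      Int.cast_one]
    ring
  have him : (meshPoint δ (p + Pi.single 0 1) - meshPoint δ p).im = 0 := by
    rw [Complex.sub_im, meshPoint_im, meshPoint_im, add_single_zero_apply_one, sub_self]
  have : meshPoint δ (p + Pi.single 0 1) - meshPoint δ p = (δ : ℂ) := Complex.ext hre him
  rw [this, Complex.norm_real, Real.norm_eq_abs, abs_of_nonneg hδ]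

/-- A brick-wall bond between two lattice points whose mesh points lie in a convex subset `U ⊆ Ω`
all of whose lattice points belong to the discrete domain is an edge of the brick-wall part
`Ω_δ ⊓ brickWall` of the discrete domain graph. [folklore] -/
theorem bw_adj_of_mem {Ω U : Set ℂ} {δ : ℝ} (hU : Convex ℝ U) (hUΩ : U ⊆ Ω)
    (hdom : ∀ p : Site 2, meshPoint δ p ∈ U → p ∈ meshDomain Ω δ) {u v : Site 2}
    (huv : SAW.brickWallGraph.Adj u v) (hu : meshPoint δ u ∈ U) (hv : meshPoint δ v ∈ U) :
    (discreteDomainGraph Ω δ ⊓ SAW.brickWallGraph).Adj u v :=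
  ⟨discreteDomainGraph_adj_iff.2 ⟨meshGraph_adj_iff.2
    ⟨huv.1, (hU.segment_subset hu hv).trans (hUΩ.trans subset_closure)⟩, hdom u hu, hdom v hv⟩, huv⟩

/-- **Brick-wall staircase.** In the setting of `bw_adj_of_mem`, two lattice points `a`, `b` such
that every lattice point of the box spanned by `a`, `b`, together with its right neighbour, has its
mesh point in `U`, are joined in `Ω_δ ⊓ brickWall`: move horizontally (always brick-wall bonds) and
vertically, bypassing each deleted vertical bond `{(x,y),(x,y+1)}`, `x + y` odd, through the column
`x + 1`. Induction on the lattice distance, as `meshVertexGraph_reachable_of_rectangle_subset`.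
[folklore] -/
theorem bw_reachable_of_box {Ω U : Set ℂ} {δ : ℝ} (hU : Convex ℝ U) (hUΩ : U ⊆ Ω)
    (hdom : ∀ p : Site 2, meshPoint δ p ∈ U → p ∈ meshDomain Ω δ) :
    ∀ (n : ℕ) (a b : Site 2), (b 0 - a 0).natAbs + (b 1 - a 1).natAbs = n →
      (∀ p : Site 2, (∀ j, p j ∈ uIcc (a j) (b j)) →
        meshPoint δ p ∈ U ∧ meshPoint δ (p + Pi.single 0 1) ∈ U) →
      (discreteDomainGraph Ω δ ⊓ SAW.brickWallGraph).Reachable a b := by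
  intro n
  induction n with
  | zero =>
    intro a b hn _
    have hab : a = b := by
      ext j; fin_cases j <;> simp <;> omega
    subst hab
    rfl
  | succ n ih =>
    intro a b hn hbox
    -- choose a coordinate `i` in which `a` and `b` differ, and the sign `s` pointing to `b`
    obtain ⟨i, hi⟩ : ∃ i : Fin 2, a i ≠ b i := by
      by_contra! h
      have h0 := h 0; have h1 := h 1
      omega
    set s : ℤ := if a i < b i then 1 else -1 with hs_def
    have hs : s = 1 ∨ s = -1 := by rw [hs_def]; split_ifs <;> simp
    set a' : Site 2 := a + Pi.single i s with ha'_def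
    have ha'j : ∀ j, a' j = a j + if j = i then s else 0 := fun j => add_single_apply a i j s
    -- `a'` lies coordinatewise between `a` and `b`
    have hbetween : ∀ j, a' j ∈ uIcc (a j) (b j) := by
      intro j
      rw [ha'j j, mem_uIcc]
      by_cases hji : j = i
      · subst hji
        rw [if_pos rfl, hs_def]
        split_ifs with hlt
        · left; constructor <;> omega
        · right; constructor <;> omega
      · rw [if_neg hji, add_zero]
        rcases le_total (a j) (b j) with h | h
        · exact Or.inl ⟨le_rfl, h⟩
        · exact Or.inr ⟨h, le_rfl⟩
    have haa : ∀ j, a j ∈ uIcc (a j) (b j) := fun j => left_mem_uIcc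
    -- the box spanned by `a'`, `b` lies in the box spanned by `a`, `b`
    have hbox' : ∀ p : Site 2, (∀ j, p j ∈ uIcc (a' j) (b j)) →
        meshPoint δ p ∈ U ∧ meshPoint δ (p + Pi.single 0 1) ∈ U := fun p hp =>
      hbox p fun j => uIcc_subset_uIcc (hbetween j) right_mem_uIcc (hp j)
    -- the lattice distance to `b` has dropped by one
    have hsgn : (a i < b i ∧ s = 1) ∨ (b i < a i ∧ s = -1) := by
      rw [hs_def]
      split_ifs with h
      · exact Or.inl ⟨h, rfl⟩
      · exact Or.inr ⟨lt_of_le_of_ne (not_lt.1 h) (Ne.symm hi), rfl⟩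
    have h0 := ha'j 0
    have h1 := ha'j 1
    have hn' : (b 0 - a' 0).natAbs + (b 1 - a' 1).natAbs = n := by
      fin_cases i
      · simp only [Fin.zero_eta, Fin.isValue, ↓reduceIte, one_ne_zero] at h0 h1 hsgn
        rw [h0, h1]
        omega
      · simp only [Fin.mk_one, Fin.isValue, zero_ne_one, ↓reduceIte] at h0 h1 hsgn
        rw [h0, h1]
        omega
    refine SimpleGraph.Reachable.trans ?_ (ih a' b hn' hbox')
    -- the step `a → a'` inside `Ω_δ ⊓ brickWall` (directly, or through the column to the right)
    have hadj := fun {u v : Site 2} (huv : SAW.brickWallGraph.Adj u v) (hu : meshPoint δ u ∈ U)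
      (hv : meshPoint δ v ∈ U) => bw_adj_of_mem hU hUΩ hdom huv hu hv
    obtain ⟨haU, haU'⟩ := hbox a haa
    obtain ⟨ha'U, ha'U'⟩ := hbox a' hbetween
    have hr0 := add_single_zero_apply_zero
    have hr1 := add_single_zero_apply_one
    fin_cases i
    · -- horizontal step: always a brick-wall bond
      simp only [Fin.zero_eta, Fin.isValue, ↓reduceIte, one_ne_zero, add_zero] at h0 h1
      refine (hadj ?_ haU ha'U).reachable
      rw [SAW.brickWallGraph_adj_coord]
      left
      omega
    · simp only [Fin.mk_one, Fin.isValue, zero_ne_one, ↓reduceIte, add_zero] at h0 h1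
      by_cases hpar : (a 0 + min (a 1) (a' 1)) % 2 = 0
      · -- an even vertical bond: a brick-wall bond
        refine (hadj ?_ haU ha'U).reachable
        rw [SAW.brickWallGraph_adj_coord]
        right
        rcases hs with hs1 | hs1 <;> rw [hs1] at h1
        · refine ⟨h0, Or.inl ⟨h1, ?_⟩⟩
          rw [h1, min_eq_left (by omega)] at hpar
          exact hpar
        · refine ⟨h0, Or.inr ⟨by omega, ?_⟩⟩
          rw [h1, min_eq_right (by omega)] at hpar
          rw [h0]
          omega
      · -- an odd vertical bond: bypass through the column `a 0 + 1`
        have e1 : SAW.brickWallGraph.Adj a (a + Pi.single 0 1) := by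
          rw [SAW.brickWallGraph_adj_coord]
          left
          exact ⟨Or.inl (hr0 a), hr1 a⟩
        have e2 : SAW.brickWallGraph.Adj (a + Pi.single 0 1) (a' + Pi.single 0 1) := by
          rw [SAW.brickWallGraph_adj_coord]
          right
          rw [hr0, hr0, hr1, hr1]
          rcases hs with hs1 | hs1 <;> rw [hs1] at h1
          · refine ⟨by omega, Or.inl ⟨h1, ?_⟩⟩
            rw [h1, min_eq_left (by omega)] at hpar
            omega
          · refine ⟨by omega, Or.inr ⟨by omega, ?_⟩⟩
            rw [h1, min_eq_right (by omega)] at hpar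
            rw [h0]
            omega
        have e3 : SAW.brickWallGraph.Adj (a' + Pi.single 0 1) a' := by
          rw [SAW.brickWallGraph_adj_coord]
          left
          exact ⟨Or.inr (hr0 a'), (hr1 a').symm⟩
        exact ((hadj e1 haU haU').reachable.trans (hadj e2 haU' ha'U').reachable).trans
          (hadj e3 ha'U' ha'U).reachable

/-- **Brick-wall connectivity of the bulk** (brick-wall form of `meshVertexGraph_reachable_of_mem_bulk`).
If `V` is preconnected, every ball of radius `ρ ≥ 4δ` about a point of `V` lies in `Ω`, and every
lattice point whose mesh point is within `ρ` of `V` belongs to the discrete domain `Ω_δ`, then any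
two lattice points with mesh points in `V` are joined in `Ω_δ ⊓ brickWall`: the component of the
lattice point nearest to `w ∈ V` is a locally constant function of `w` (brick-wall staircase in a box
of size `O(δ)`, `bw_reachable_of_box`), hence constant on `V`. [folklore] -/
theorem bw_reachable_of_mem_bulk {Ω V : Set ℂ} {δ ρ : ℝ} (hδ : 0 < δ) (hδρ : 4 * δ ≤ ρ)
    (hV : IsPreconnected V) (hVΩ : ∀ w ∈ V, ball w ρ ⊆ Ω)
    (hdom : ∀ w ∈ V, ∀ p : Site 2, dist (meshPoint δ p) w < ρ → p ∈ meshDomain Ω δ)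
    {x y : Site 2} (hx : meshPoint δ x ∈ V) (hy : meshPoint δ y ∈ V) :
    (discreteDomainGraph Ω δ ⊓ SAW.brickWallGraph).Reachable x y := by
  classical
  set H := discreteDomainGraph Ω δ ⊓ SAW.brickWallGraph with hH_def
  let f : ℂ → H.ConnectedComponent := fun w => H.connectedComponentMk (nearestSite δ w)
  letI : TopologicalSpace H.ConnectedComponent := ⊥
  haveI : DiscreteTopology H.ConnectedComponent := ⟨rfl⟩
  -- `f` is constant on the ball of radius `δ / 4` about any point of `V`
  have key : ∀ z ∈ V, ∀ w, dist w z < δ / 4 → f w = f z := by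
    intro z hz w hw
    have h1 : dist (meshPoint δ (nearestSite δ z)) z < 5 / 4 * δ :=
      (dist_meshPoint_nearestSite_le hδ z).trans_lt (by linarith)
    have h2 : dist (meshPoint δ (nearestSite δ w)) z < 5 / 4 * δ :=
      calc dist (meshPoint δ (nearestSite δ w)) z
          ≤ dist (meshPoint δ (nearestSite δ w)) w + dist w z := dist_triangle _ _ _
        _ < δ + δ / 4 := add_lt_add_of_le_of_lt (dist_meshPoint_nearestSite_le hδ w) hw
        _ = 5 / 4 * δ := by ring
    have hR := rectangle_subset_ball h2 h1
    have hUΩ : ball z (4 * δ) ⊆ Ω := (ball_subset_ball hδρ).trans (hVΩ z hz)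
    have hdomU : ∀ p : Site 2, meshPoint δ p ∈ ball z (4 * δ) → p ∈ meshDomain Ω δ :=
      fun p hp => hdom z hz p ((mem_ball.1 hp).trans_le hδρ)
    apply SimpleGraph.ConnectedComponent.sound
    refine bw_reachable_of_box (convex_ball z (4 * δ)) hUΩ hdomU _ _ _ rfl fun p hp => ?_
    have hpR : dist (meshPoint δ p) z < 2 * (5 / 4 * δ) :=
      mem_ball.1 (hR (meshPoint_mem_rectangle hδ.le hp))
    refine ⟨mem_ball.2 (by linarith), mem_ball.2 ?_⟩
    calc dist (meshPoint δ (p + Pi.single 0 1)) z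
        ≤ dist (meshPoint δ (p + Pi.single 0 1)) (meshPoint δ p) + dist (meshPoint δ p) z :=
          dist_triangle _ _ _
      _ < δ + 2 * (5 / 4 * δ) := by rw [dist_meshPoint_add_single_zero hδ.le]; linarith
      _ ≤ 4 * δ := by linarith
  have hcont : ContinuousOn f V := by
    intro z hz
    refine ContinuousAt.continuousWithinAt ((continuousAt_const (y := f z)).congr ?_)
    filter_upwards [ball_mem_nhds z (by positivity : (0 : ℝ) < δ / 4)] with w hw
    exact (key z hz w (mem_ball.1 hw)).symm
  have hfxy := hV.constant hcont hx hy
  simp only [f, nearestSite_meshPoint hδ.ne'] at hfxy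
  exact SimpleGraph.ConnectedComponent.exact hfxy

/-! ### 2. Brick-wall-good endpoint approximations exist -/

/-- Every vertex of a walk of `Ω_δ` other than its starting vertex lies in the discrete domain
`Ω_δ` (it is the head of a dart). [folklore] -/
theorem mem_meshDomain_of_mem_support_of_ne {Ω : Set ℂ} {δ : ℝ} {u v : Site 2}
    (p : (discreteDomainGraph Ω δ).Walk u v) {w : Site 2} (hw : w ∈ p.support) (hne : w ≠ u) :
    w ∈ meshDomain Ω δ := by
  have htail : w ∈ p.support.tail := by
    rw [← SimpleGraph.Walk.cons_tail_support] at hw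
    rcases List.mem_cons.1 hw with h | h
    · exact absurd h hne
    · exact h
  rw [← SimpleGraph.Walk.map_snd_darts] at htail
  obtain ⟨d, -, rfl⟩ := List.mem_map.1 htail
  exact (discreteDomainGraph_adj_iff.1 d.adj).2.2

/-- **A brick-wall walk makes the straight brick-wall law a probability measure.** If `a` and `b`
are joined in `Ω_δ ⊓ brickWall` and there are finitely many SAWs from `a` to `b`, then
`brickWallLaw Ω δ 0 a b` is a probability measure: a brick-wall self-avoiding path (`Walk.bypass`)
uses no odd vertical bond, so its weight is `x_c(0)^{|γ|} · 0⁰ = x_c(0)^{|γ|} > 0`. [folklore] -/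
theorem isProbabilityMeasure_brickWallLaw_zero_of_reachable {Ω : Set ℂ} {δ : ℝ} {a b : Site 2}
    [Finite (SAW.DomainSAW Ω δ a b)]
    (h : (discreteDomainGraph Ω δ ⊓ SAW.brickWallGraph).Reachable a b) :
    IsProbabilityMeasure (SAW.brickWallLaw Ω δ 0 a b) := by
  classical
  obtain ⟨p⟩ := h
  have hq : p.bypass.IsPath := p.bypass_isPath
  have hedges : ∀ e ∈ p.bypass.edges, e ∈ (discreteDomainGraph Ω δ).edgeSet := fun e he =>
    SimpleGraph.edgeSet_subset_edgeSet.2 inf_le_left (p.bypass.edges_subset_edgeSet he)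
  let γ : SAW.DomainSAW Ω δ a b := ⟨p.bypass.transfer _ hedges, hq.transfer hedges⟩
  have hodd : SAW.oddVerticalCount γ.walk = 0 := by
    show SAW.oddVerticalCount (p.bypass.transfer _ hedges) = 0
    rw [SAW.oddVerticalCount_transfer, SAW.oddVerticalCount_eq_zero_iff]
    intro d _
    exact d.adj.2.2
  refine SAW.isProbabilityMeasure_brickWallLaw (fun h0 => ?_) SAW.brickWallWeight_univ_lt_top.ne
  have h1 : SAW.brickWallWeight Ω δ 0 a b {γ} = 0 := measure_mono_null (subset_univ _) h0
  rw [SAW.brickWallWeight_singleton, hodd, pow_zero, mul_one, ENNReal.ofReal_eq_zero] at h1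
  exact absurd h1 (not_le.2 (pow_pos (SAW.criticalFugacityT_pos le_rfl zero_le_one) _))

/-- **Brick-wall-good endpoint approximations exist.** Every Dobrushin domain `E` admits a `ℤ²`
endpoint approximation `(a_δ, b_δ)` along which the straight critical brick-wall law
`brickWallLaw E δ 0 (a δ) (b δ)` is eventually a probability measure. Construction: interior points
`z_n → E.pt 0`, `w_n → E.pt 1`; a bulk neighbourhood `V_n ∋ z_n, w_n` at distance `> ρ_n` from `Eᶜ`
(`exists_isOpen_isPreconnected_bulk`); for small `δ` all lattice points within `ρ_n / 2` of `Eᶜ`'s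
far side lie in the discrete domain (`JordanDomain.exists_forall_mem_meshDomain_and_reachable` for the
compact `{infDist(·, Eᶜ) ≥ ρ_n / 2}`), so the sites nearest to `z_n`, `w_n` are brick-wall joined
(`bw_reachable_of_mem_bulk`) and the law is a probability measure
(`isProbabilityMeasure_brickWallLaw_zero_of_reachable`); a diagonal stage selection
(`exists_stage_tendsto_atTop`) finishes. [folklore] -/
theorem exists_isEndpointApprox_isProbabilityMeasure_brickWallLaw (E : DobrushinDomain) :
    ∃ a b : ℝ → Site 2, SAW.IsEndpointApprox E a b ∧
      ∀ᶠ δ in 𝓝[>] (0 : ℝ), IsProbabilityMeasure (SAW.brickWallLaw E.carrier δ 0 (a δ) (b δ)) := by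
  classical
  set Ω := E.carrier with hΩ_def
  have hΩo : IsOpen Ω := E.isOpen
  have hΩb : Bornology.IsBounded Ω := E.isBounded
  have hΩc : IsConnected Ω := E.isConnected
  have hne : Ωᶜ.Nonempty := nonempty_compl.2 E.carrier_ne_univ
  -- interior points `z i n → E.pt i`
  have hz : ∀ (i : Fin 2) (n : ℕ), ∃ z ∈ Ω, dist z (E.pt i) < 1 / ((n : ℝ) + 1) := by
    intro i n
    obtain ⟨z, hz, hd⟩ := Metric.mem_closure_iff.1
      (frontier_subset_closure (E.pt_mem_frontier i)) (1 / ((n : ℝ) + 1)) (by positivity)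
    exact ⟨z, hz, by rwa [dist_comm]⟩
  choose z hzΩ hzd using hz
  -- stage `n`: a bulk neighbourhood of the two points, and the mesh threshold below which its
  -- lattice points are brick-wall joined inside the discrete domain
  have hstage : ∀ n : ℕ, ∃ t > 0, ∀ δ, 0 < δ → δ < t →
      (discreteDomainGraph Ω δ ⊓ SAW.brickWallGraph).Reachable
        (nearestSite δ (z 0 n)) (nearestSite δ (z 1 n)) := by
    intro n
    have hKΩ : ({z 0 n, z 1 n} : Set ℂ) ⊆ Ω := by
      rintro x (rfl | rfl)
      · exact hzΩ 0 n
      · exact hzΩ 1 n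
    obtain ⟨V, hVo, hVc, hKV, -, ρ, hρ, hVρ⟩ := exists_isOpen_isPreconnected_bulk hΩo hΩc hne
      ((Set.finite_singleton (z 1 n)).insert (z 0 n)).isCompact hKΩ
    have hz0V : z 0 n ∈ V := hKV (mem_insert _ _)
    have hz1V : z 1 n ∈ V := hKV (mem_insert_of_mem _ (mem_singleton _))
    obtain ⟨r₀, hr₀, hr₀V⟩ := Metric.isOpen_iff.1 hVo _ hz0V
    obtain ⟨r₁, hr₁, hr₁V⟩ := Metric.isOpen_iff.1 hVo _ hz1V
    -- the compact `K' = {infDist(·, Ωᶜ) ≥ ρ / 2}` and its Jordan threshold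
    set K' : Set ℂ := {x | ρ / 2 ≤ infDist x Ωᶜ} with hK'_def
    have hK'Ω : K' ⊆ Ω := fun x hx => by
      by_contra h
      have : infDist x Ωᶜ = 0 := infDist_zero_of_mem h
      have hx' : ρ / 2 ≤ infDist x Ωᶜ := hx
      linarith
    have hK'c : IsCompact K' :=
      Metric.isCompact_of_isClosed_isBounded (isClosed_le continuous_const (continuous_infDist_pt _))
        (hΩb.subset hK'Ω)
    obtain ⟨δ₀, hδ₀, hgood⟩ := E.toJordanDomain.exists_forall_mem_meshDomain_and_reachable hK'c hK'Ω
    refine ⟨min δ₀ (min (ρ / 8) (min r₀ r₁)), by positivity, fun δ hδ hδt => ?_⟩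
    have hδδ₀ : δ < δ₀ := hδt.trans_le (min_le_left _ _)
    have hδρ : 4 * δ ≤ ρ / 2 := by
      have := hδt.le.trans ((min_le_right _ _).trans (min_le_left _ _)); linarith
    have hδr₀ : δ < r₀ := hδt.trans_le ((min_le_right _ _).trans ((min_le_right _ _).trans (min_le_left _ _)))
    have hδr₁ : δ < r₁ := hδt.trans_le ((min_le_right _ _).trans ((min_le_right _ _).trans (min_le_right _ _)))
    have hVΩ : ∀ w ∈ V, ball w (ρ / 2) ⊆ Ω := fun w hw =>
      (ball_subset_ball (by linarith [hVρ w hw])).trans ball_infDist_compl_subset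
    have hdom : ∀ w ∈ V, ∀ p : Site 2, dist (meshPoint δ p) w < ρ / 2 → p ∈ meshDomain Ω δ := by
      intro w hw p hp
      refine (hgood δ hδ hδδ₀).1 p ?_
      show ρ / 2 ≤ infDist (meshPoint δ p) Ωᶜ
      have h1 := hVρ w hw
      have h2 := infDist_le_infDist_add_dist (s := Ωᶜ) (x := w) (y := meshPoint δ p)
      rw [dist_comm] at h2
      linarith
    refine bw_reachable_of_mem_bulk hδ hδρ hVc hVΩ hdom (hr₀V ?_) (hr₁V ?_)
    · exact mem_ball.2 ((dist_meshPoint_nearestSite_le hδ _).trans_lt hδr₀)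
    · exact mem_ball.2 ((dist_meshPoint_nearestSite_le hδ _).trans_lt hδr₁)
  choose t ht hreach using hstage
  -- diagonal stage selection
  obtain ⟨N, hN, hNtop⟩ := exists_stage_tendsto_atTop (p := fun n δ => 0 < δ ∧ δ < t n) ht
    (fun n δ h₁ h₂ => ⟨h₁, h₂⟩)
  refine ⟨fun δ => nearestSite δ (z 0 (N δ)), fun δ => nearestSite δ (z 1 (N δ)),
    ⟨?_, tendsto_meshPoint_nearestSite_of_tendsto (hzd 0) hNtop,
      tendsto_meshPoint_nearestSite_of_tendsto (hzd 1) hNtop⟩, ?_⟩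
  · filter_upwards [hN] with δ ⟨hδ, hlt⟩
    exact (hreach (N δ) δ hδ hlt).mono inf_le_left
  · filter_upwards [hN] with δ ⟨hδ, hlt⟩
    haveI := SAW.finite_domainSAW hΩb hδ (nearestSite δ (z 0 (N δ))) (nearestSite δ (z 1 (N δ)))
    exact isProbabilityMeasure_brickWallLaw_zero_of_reachable (hreach (N δ) δ hδ hlt)

end Summit.CriticalPhenomena.SAWScalingLimit.Cruxes.ModulusUniversality.Birth

end
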